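import Literature.Barriers.AnomalousDissipation.ShearFlowViscositySelection
import Literature.Barriers.AnomalousDissipation.ShearFlowViscositySelectionPerturbed
import Literature.Analysis.FluidPDE.NSUniqueness2HalfD
import Literature.Analysis.FluidPDE.NSStability2HalfD
import Literature.Analysis.FunctionSpaces.TorusAxisAverage
import HarnessLib

/-!
# Symmetry retention: Leray–Hopf solutions and their vanishing-viscosity limits do not break the
`x₃`-invariance of the datum (Bardos–Lopes Filho–Niu–Nussenzveig Lopes–Titi 2013, §1, Thm. 3.1,
Thm. 4.4) — the symmetry twin of the shear-flow selection barrier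

Companion (theorem-only) to `Literature/Barriers/AnomalousDissipation/ShearFlowViscositySelection.lean`
(`BardosTitiWiedemann2012_thm5`: for parallel shear data the vanishing-viscosity limit of every
Leray–Hopf family is the conservative shear flow). The selection theorem identifies the limit only
inside the parallel shear class; for *every* `x₃`-invariant datum the literature prints a weaker
but much broader exclusion, by symmetry retention instead of identification of the limit:
"any Leray-Hopf weak solution of the three dimensional Navier-Stokes equations which starts
symmetric will stay symmetric for positive time, ruling out spontaneous symmetry breaking within
this class of weak solutions" (Bardos et al. 2013, §1; Thm. 3.1 and Rem. 3.1), and "essentially any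
limit of `x₃`-independent flows will be `x₃`-independent as well" (op. cit. §4, made quantitative
for perturbed data `‖u₀ - u₀^ν‖ = o(e^{-C/ν⁴})` in Thm. 4.4), whereas dissipative weak Euler
solutions that *break* the `x₃`-invariance exist for the flat vortex sheet (Székelyhidi 2011) and
for an `L²`-dense set of planar data (Wiedemann, C. R. Math. 351 (2013), Thm. 1), so that "for an
`L²`-dense subset of two-dimensional initial data, there exist dissipative weak solutions of the
3-D incompressible Euler equations which are not a vanishing viscosity limit of Leray-Hopf
solutions of Navier-Stokes with the same initial data" (Wiedemann 2013, Cor. 3).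

## This file (all proved; zero force, exact data)

* `isSpaceTimeTest_comp_add_space`, `isSpaceTimeTestIoo_comp_add_space` — spatial translates of
  space–time test fields are space–time test fields.
* `lerayHopf_translate_ae_eq` — **viscous symmetry retention** on `T³`: for a weakly
  divergence-free datum `u₀ ∈ L²(T³)` invariant under all translations along the third axis,
  every Leray–Hopf weak solution `u` of the unforced Navier–Stokes equations on `[0,T)` has
  `u(t, · + s e₃) = u(t, ·)` a.e., for every `t ∈ (0,T]` and every `s` (Bardos et al. 2013, §1 and
  Rem. 3.1: the tree's weak–strong uniqueness theorem `Torus.IsLerayHopfOn.ae_eq_of_invariant`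
  against the invariant Hopf solution `hopf_existence_torus_invariant_holds`).
* `tendstoWeakStar_limit_translate_eq` — **inviscid symmetry retention for exact-data
  vanishing-viscosity limits**: if Leray–Hopf solutions `u_j` (viscosities `ν_j > 0`) with such a
  datum converge weak-* in `L^∞(0,T;L²(T³))` (accepted `Torus.TendstoWeakStar`) to `v`, then `v` is
  invariant under the translations along the third axis as a distribution on `(0,T) × T³`:
  `∫₀ᵀ∫ ⟪v(t, x + s e₃), ψ(t,x)⟫ = ∫₀ᵀ∫ ⟪v, ψ⟫` for every smooth test field `ψ` supported in
  `(0,T)` (Bardos et al. 2013, Thm. 4.4, the case `u₀^ν = u₀`; their proof, with the stability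
  estimate replaced by exact invariance of each `u_j`).
* `tendstoWeakStar_limit_translate_eq_of_perturbedData` — **the torus form of Thm. 4.4 itself**
  (perturbed data): the same conclusion for Leray–Hopf solutions `u_j` issued from ARBITRARY data
  `u₀ʲ ∈ L²(T³)` with `‖u₀ʲ - u₀‖₂² · exp(ν_j T + 162 C² ‖u₀‖₂² / ν_j²) → 0`,
  `C = Torus.anisotropicConst` (the tree's form of the printed modulus `o(e^{-C/ν⁴})`,
  `Torus.IsLerayHopfOn.integral_norm_sub_sq_le_mul_exp_of_invariant`; Bardos et al. 2013, Thm. 3.1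
  and Thm. 4.4): the `u_j` are compared with the invariant exact-datum Hopf solutions `U_j`, whose
  pairings with a test field and with its translate coincide, and the stability estimate makes the
  pairings of `u_j - U_j` vanish in the limit (added 2026-08-15, same audit).

Nothing here asserts what the symmetric limit *is* (outside the parallel class that is open for
rough planar data), nor anything about `ν`-dependent data beyond the stability modulus (as for
`BardosTitiWiedemann2012_thm5_perturbedData`, data converging more slowly — algebraically, say —
are open) or about forces (Bardos et al. 2013, Rem. 3.3, prints the forced form for symmetric
forces; not formalised).

## References

* C. Bardos, M. C. Lopes Filho, D. Niu, H. J. Nussenzveig Lopes, E. S. Titi, SIAM J. Math. Anal.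
  45 (2013) 1871–1885 = arXiv:1201.2742, §1, Thm. 3.1, Rem. 3.1, Rem. 3.3, §4, Thm. 4.4
  (`BardosEtAl2013`).
* E. Wiedemann, C. R. Math. Acad. Sci. Paris 351 (2013) 907–910 = arXiv:1310.5925, Thm. 1, Cor. 3
  (`Wiedemann2013`).
* L. Székelyhidi Jr., C. R. Math. Acad. Sci. Paris 349 (2011) 1063–1066, Thm. 1.1 (`Szekelyhidi2011`).
-/

open MeasureTheory Set Filter Topology UnitAddTorus
open scoped ENNReal NNReal InnerProductSpace

noncomputable section

namespace Literature.Barriers.AnomalousDissipation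

/-! ## Spatial translates of space–time test fields -/

section TestFields

variable {d : Type*} [Fintype d] {F : Type*} [NormedAddCommGroup F] [NormedSpace ℝ F]

/-- **Spatial translates of test fields**: if `ψ` is a space–time test field on `T^d × [0,T)`,
so is `(t, x) ↦ ψ t (x + a)` for every `a ∈ T^d` (the space–time lift is composed with the
affine map `(t, y) ↦ (t, y + b)`, `proj b = a`; the time support is unchanged). [folklore] -/
theorem isSpaceTimeTest_comp_add_space {T : ℝ} {ψ : ℝ → UnitAddTorus d → F}
    (hψ : Literature.Analysis.FunctionSpaces.Torus.IsSpaceTimeTest T ψ) (a : UnitAddTorus d) :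
    Literature.Analysis.FunctionSpaces.Torus.IsSpaceTimeTest T (fun t x => ψ t (x + a)) := by
  obtain ⟨hs, T', hT', h0⟩ := hψ
  obtain ⟨b, rfl⟩ := Literature.Analysis.FunctionSpaces.Torus.proj_surjective a
  refine ⟨?_, T', hT', fun t ht => ?_⟩
  · have hfun : Literature.Analysis.FunctionSpaces.Torus.stLift
          (fun t x => ψ t (x + Literature.Analysis.FunctionSpaces.Torus.proj b)) =
        Literature.Analysis.FunctionSpaces.Torus.stLift ψ ∘
          fun p : ℝ × EuclideanSpace ℝ d => (p.1, p.2 + b) := by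
      funext p
      simp [Literature.Analysis.FunctionSpaces.Torus.stLift,
        Literature.Analysis.FunctionSpaces.Torus.proj_add]
    rw [hfun]
    exact hs.comp (contDiff_fst.prodMk (contDiff_snd.add contDiff_const))
  · funext x
    simp only [h0 t ht, Pi.zero_apply]

/-- Spatial translates of test fields supported in the open time interval `(0,T)` are again
such test fields. [folklore] -/
theorem isSpaceTimeTestIoo_comp_add_space {T : ℝ} {ψ : ℝ → UnitAddTorus d → F}
    (hψ : Literature.Analysis.FunctionSpaces.Torus.IsSpaceTimeTestIoo T ψ) (a : UnitAddTorus d) :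
    Literature.Analysis.FunctionSpaces.Torus.IsSpaceTimeTestIoo T (fun t x => ψ t (x + a)) := by
  obtain ⟨h, ε, hε, h0⟩ := hψ
  refine ⟨isSpaceTimeTest_comp_add_space h a, ε, hε, fun t ht => ?_⟩
  funext x
  simp only [h0 t ht, Pi.zero_apply]

end TestFields

/-! ## Viscous symmetry retention (Bardos et al. 2013, §1, Thm. 3.1 / Rem. 3.1) -/

/-- **Leray–Hopf solutions do not break the `x₃`-invariance of the datum** (Bardos–Lopes
Filho–Niu–Nussenzveig Lopes–Titi 2013, §1: "any Leray-Hopf weak solution of the three dimensional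
Navier-Stokes equations which starts symmetric will stay symmetric for positive time"; Thm. 3.1 and
Rem. 3.1). On `T³`, for `ν > 0`, `T > 0` and a weakly divergence-free datum `u₀ ∈ L²(T³)` with
`u₀(x + s e₃) = u₀(x)` for all `s`, every Leray–Hopf weak solution `u` of the unforced
Navier–Stokes equations on `[0,T)` with datum `u₀` satisfies `u(t, · + s e₃) = u(t, ·)` almost
everywhere, for every `t ∈ (0,T]` and every `s ∈ ℝ/ℤ`. Proof: Hopf's theorem run in the closed
invariant class (`hopf_existence_torus_invariant_holds`) gives an everywhere-invariant Leray–Hopf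
solution `U`; `u(t) = U(t)` a.e. by the tree's weak–strong uniqueness theorem
`Torus.IsLerayHopfOn.ae_eq_of_invariant` (op. cit. Thm. 3.1), and a.e. equalities are preserved by
the measure-preserving translation. [cite: BardosEtAl2013, §1, Thm. 3.1 and Rem. 3.1] -/
theorem lerayHopf_translate_ae_eq {ν T : ℝ} (hν : 0 < ν) (hT : 0 < T) {u₀ : UnitAddTorus (Fin 3) → EuclideanSpace ℝ (Fin 3)}
    (hu₀ : MemLp u₀ 2 volume) (hdiv : Literature.Analysis.FunctionSpaces.Torus.IsWeaklyDivFree u₀)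
    (hinv₀ : ∀ (s : UnitAddCircle) (x : UnitAddTorus (Fin 3)), u₀ (x + Pi.single (2 : Fin 3) s) = u₀ x)
    {u : ℝ → UnitAddTorus (Fin 3) → EuclideanSpace ℝ (Fin 3)} (hu : Literature.Analysis.FluidPDE.Torus.IsLerayHopfOn T ν 0 u₀ u)
    {t : ℝ} (ht : t ∈ Ioc 0 T) (s : UnitAddCircle) :
    (fun x => u t (x + Pi.single (2 : Fin 3) s)) =ᵐ[volume] u t := by
  have hf : AEStronglyMeasurable
      (Literature.Analysis.FunctionSpaces.Torus.stLift (0 : ℝ → UnitAddTorus (Fin 3) → EuclideanSpace ℝ (Fin 3)))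
      (volume.restrict (Ioi 0 ×ˢ univ)) :=
    aestronglyMeasurable_const (b := (0 : EuclideanSpace ℝ (Fin 3)))
  have hf₂ : ∀ T', 0 < T' → ∫⁻ s in Ioo 0 T', ∫⁻ x : UnitAddTorus (Fin 3), ‖(0 : ℝ → UnitAddTorus (Fin 3) → EuclideanSpace ℝ (Fin 3)) s x‖ₑ ^ 2 < ⊤ :=
    fun T' _ => by simp
  obtain ⟨U, hUg, hUinv⟩ := Literature.Analysis.FluidPDE.hopf_existence_torus_invariant_holds ν hν u₀
    hu₀ hdiv hinv₀ 0 hf hf₂ (fun _ _ _ => rfl)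
  have hU : Literature.Analysis.FluidPDE.Torus.IsLerayHopfOn T ν 0 u₀ U := hUg T hT
  have h1 : u t =ᵐ[volume] U t := hu.ae_eq_of_invariant hU hν hT hu₀ hUinv t ht
  have h2 : (u t ∘ fun x : UnitAddTorus (Fin 3) => x + Pi.single (2 : Fin 3) s) =ᵐ[volume]
      (U t ∘ fun x : UnitAddTorus (Fin 3) => x + Pi.single (2 : Fin 3) s) :=
    (Literature.Analysis.FunctionSpaces.Torus.measurePreserving_add_single (d := Fin 3) (2 : Fin 3)
      s).quasiMeasurePreserving.ae_eq_comp h1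
  have h3 : (U t ∘ fun x : UnitAddTorus (Fin 3) => x + Pi.single (2 : Fin 3) s) =ᵐ[volume] U t :=
    Filter.Eventually.of_forall fun x => hUinv t s x
  exact (h2.trans h3).trans h1.symm

/-! ## Inviscid symmetry retention for exact-data vanishing-viscosity limits (op. cit. Thm. 4.4) -/

/-- **Vanishing-viscosity limits do not break the `x₃`-invariance of the datum**
(Bardos–Lopes Filho–Niu–Nussenzveig Lopes–Titi 2013, Thm. 4.4, the exact-data case `u₀^ν = u₀`:
"It is easy to see that essentially any limit of `x₃`-independent flows will be `x₃`-independent as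
well", op. cit. §4). On `T³`: let `u₀ ∈ L²` be weakly divergence free and invariant under all
translations along the third axis, let `u_j` be Leray–Hopf weak solutions of the unforced
Navier–Stokes equations on `[0,T)` with viscosities `ν_j > 0` and the same datum `u₀`, and suppose
`u_j ⇀* v` in `L^∞(0,T;L²(T³))` (accepted `Torus.TendstoWeakStar`: convergence against smooth
space–time test fields supported in `(0,T)`). Then the limit is invariant under those translations
as a distribution on `(0,T) × T³`: for every `s` and every such test field `ψ`,
`∫₀ᵀ∫ ⟪v(t, x + s e₃), ψ(t,x)⟫ dx dt = ∫₀ᵀ∫ ⟪v(t,x), ψ(t,x)⟫ dx dt`. In particular a weak Euler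
solution that breaks the symmetry of such a datum (Wiedemann 2013, Thm. 1; Székelyhidi 2011) is
not the weak-* limit of any such family (Wiedemann 2013, Cor. 3). Proof: test `u_j` against `ψ`
and against its translate `ψ(t, x - s e₃)` (a test field, `isSpaceTimeTestIoo_comp_add_space`);
by translation invariance of Haar measure and `lerayHopf_translate_ae_eq` the two pairings agree
for every `j`, so their limits agree. No convergence of `ν_j` is needed. [cite: BardosEtAl2013, Thm. 4.4] -/
theorem tendstoWeakStar_limit_translate_eq {ν : ℕ → ℝ} (hν : ∀ j, 0 < ν j) {T : ℝ} (hT : 0 < T)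
    {u₀ : UnitAddTorus (Fin 3) → EuclideanSpace ℝ (Fin 3)} (hu₀ : MemLp u₀ 2 volume)
    (hdiv : Literature.Analysis.FunctionSpaces.Torus.IsWeaklyDivFree u₀)
    (hinv₀ : ∀ (s : UnitAddCircle) (x : UnitAddTorus (Fin 3)), u₀ (x + Pi.single (2 : Fin 3) s) = u₀ x)
    {u : ℕ → ℝ → UnitAddTorus (Fin 3) → EuclideanSpace ℝ (Fin 3)} (hu : ∀ j, Literature.Analysis.FluidPDE.Torus.IsLerayHopfOn T (ν j) 0 u₀ (u j))
    {v : ℝ → UnitAddTorus (Fin 3) → EuclideanSpace ℝ (Fin 3)} (hlim : Literature.Analysis.FluidPDE.Torus.TendstoWeakStar u v T)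
    (s : UnitAddCircle) {ψ : ℝ → UnitAddTorus (Fin 3) → EuclideanSpace ℝ (Fin 3)}
    (hψ : Literature.Analysis.FunctionSpaces.Torus.IsSpaceTimeTestIoo T ψ) :
    ∫ t in Ioo 0 T, ∫ x, ⟪v t (x + Pi.single (2 : Fin 3) s), ψ t x⟫_ℝ =
      ∫ t in Ioo 0 T, ∫ x, ⟪v t x, ψ t x⟫_ℝ := by
  set e : UnitAddTorus (Fin 3) := Pi.single (2 : Fin 3) s with he
  -- the translated test field `ψ'(t, x) = ψ(t, x - e)`
  set ψ' : ℝ → UnitAddTorus (Fin 3) → EuclideanSpace ℝ (Fin 3) := fun t x => ψ t (x + -e) with hψ'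
  have hψ't : Literature.Analysis.FunctionSpaces.Torus.IsSpaceTimeTestIoo T ψ' :=
    isSpaceTimeTestIoo_comp_add_space hψ (-e)
  -- change of variables `x ↦ x + e` in the slice pairings (Haar measure is translation invariant)
  have hcv : ∀ (w : UnitAddTorus (Fin 3) → EuclideanSpace ℝ (Fin 3)) (t : ℝ),
      ∫ x, ⟪w x, ψ' t x⟫_ℝ = ∫ x, ⟪w (x + e), ψ t x⟫_ℝ := by
    intro w t
    rw [← integral_add_right_eq_self (fun x => ⟪w x, ψ' t x⟫_ℝ) e]
    simp [hψ']
  -- for every `j`, the two pairings of `u j` agree (viscous symmetry retention)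
  have hslice : ∀ j, ∀ t ∈ Ioo 0 T,
      ∫ x, ⟪u j t x, ψ' t x⟫_ℝ = ∫ x, ⟪u j t x, ψ t x⟫_ℝ := by
    intro j t ht
    rw [hcv]
    refine integral_congr_ae ?_
    filter_upwards [lerayHopf_translate_ae_eq (hν j) hT hu₀ hdiv hinv₀ (hu j) ⟨ht.1, ht.2.le⟩ s]
      with x hx
    rw [hx]
  have hseq : (fun j => ∫ t in Ioo 0 T, ∫ x, ⟪u j t x, ψ' t x⟫_ℝ) =
      fun j => ∫ t in Ioo 0 T, ∫ x, ⟪u j t x, ψ t x⟫_ℝ := by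
    funext j
    exact setIntegral_congr_fun measurableSet_Ioo (hslice j)
  -- pass to the limit along both test fields
  have h1 := hlim.2 ψ' hψ't
  have h2 := hlim.2 ψ hψ
  rw [hseq] at h1
  have h3 : ∫ t in Ioo 0 T, ∫ x, ⟪v t x, ψ' t x⟫_ℝ = ∫ t in Ioo 0 T, ∫ x, ⟪v t x, ψ t x⟫_ℝ :=
    tendsto_nhds_unique h1 h2
  -- undo the change of variables on the limit
  have h4 : (fun t => ∫ x, ⟪v t x, ψ' t x⟫_ℝ) = fun t => ∫ x, ⟪v t (x + e), ψ t x⟫_ℝ :=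
    funext fun t => hcv (v t) t
  rw [h4] at h3
  exact h3

/-! ## Inviscid symmetry retention under perturbation of the data (op. cit. Thm. 4.4, torus form) -/

/-- **Vanishing-viscosity limits of perturbed symmetric data do not break the symmetry**
(Bardos–Lopes Filho–Niu–Nussenzveig Lopes–Titi 2013, Thm. 4.4, torus form: printed on
`Q³` for weak-* limits of Leray–Hopf solutions with data `u₀^ν`, `‖u₀ - u₀^ν‖₂ = o(e^{-C/ν⁴})`,
`C ≥ 27‖u₀‖⁴/64`; here with the tree's inhomogeneous stability modulus). On `T³`: let `u₀ ∈ L²` be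
weakly divergence free and invariant under all translations along the third axis, `T > 0`,
`ν_j > 0`, and let `u_j` be Leray–Hopf weak solutions of the unforced Navier–Stokes equations on
`[0,T)` with viscosities `ν_j` and ARBITRARY data `u₀ʲ ∈ L²(T³)` such that
`‖u₀ʲ - u₀‖₂² · exp(ν_j T + 162 C² ‖u₀‖₂² / ν_j²) → 0`, `C = Torus.anisotropicConst`. If
`u_j ⇀* v` in `L^∞(0,T;L²(T³))` (accepted `Torus.TendstoWeakStar`), then `v` is invariant under
the translations along the third axis as a distribution on `(0,T) × T³`:
`∫₀ᵀ∫ ⟪v(t, x + s e₃), ψ(t,x)⟫ = ∫₀ᵀ∫ ⟪v, ψ⟫` for every `s` and every smooth test field `ψ`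
supported in `(0,T)`. Proof (op. cit.): compare `u_j` with the everywhere-invariant exact-datum
Hopf solution `U_j` (`hopf_existence_torus_invariant_holds`), for which the pairings with `ψ` and
with its translate `ψ(t, x - s e₃)` coincide exactly; the stability estimate
`∫‖u_j(t) - U_j(t)‖² ≤ ‖u₀ʲ - u₀‖₂² exp(ν_j t + 162C²‖u₀‖₂²/ν_j²)`
(`Torus.IsLerayHopfOn.integral_norm_sub_sq_le_mul_exp_of_invariant`, op. cit. Thm. 3.1) and the
hypothesis make both pairings of `u_j - U_j` tend to `0`, so the two limits `⟪v, ψ(·, · - s e₃)⟫`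
and `⟪v, ψ⟫` agree. No convergence of `ν_j` or of `U_j` is needed. [cite: BardosEtAl2013, Thm. 4.4] -/
theorem tendstoWeakStar_limit_translate_eq_of_perturbedData {ν : ℕ → ℝ} (hν : ∀ j, 0 < ν j)
    {T : ℝ} (hT : 0 < T) {u₀ : UnitAddTorus (Fin 3) → EuclideanSpace ℝ (Fin 3)}
    (hu₀ : MemLp u₀ 2 volume) (hdiv : Literature.Analysis.FunctionSpaces.Torus.IsWeaklyDivFree u₀)
    (hinv₀ : ∀ (s : UnitAddCircle) (x : UnitAddTorus (Fin 3)), u₀ (x + Pi.single (2 : Fin 3) s) = u₀ x)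
    (w₀ : ℕ → UnitAddTorus (Fin 3) → EuclideanSpace ℝ (Fin 3)) (hw₀ : ∀ j, MemLp (w₀ j) 2 volume)
    {u : ℕ → ℝ → UnitAddTorus (Fin 3) → EuclideanSpace ℝ (Fin 3)}
    (hu : ∀ j, Literature.Analysis.FluidPDE.Torus.IsLerayHopfOn T (ν j) 0 (w₀ j) (u j))
    (hclose : Tendsto (fun j => (∫ x, ‖w₀ j x - u₀ x‖ ^ 2) *
        Real.exp (ν j * T + 162 * Literature.Analysis.FunctionSpaces.Torus.anisotropicConst.toReal ^ 2 /
          ν j ^ 2 * ∫ x, ‖u₀ x‖ ^ 2)) atTop (𝓝 0))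
    {v : ℝ → UnitAddTorus (Fin 3) → EuclideanSpace ℝ (Fin 3)}
    (hlim : Literature.Analysis.FluidPDE.Torus.TendstoWeakStar u v T)
    (s : UnitAddCircle) {ψ : ℝ → UnitAddTorus (Fin 3) → EuclideanSpace ℝ (Fin 3)}
    (hψ : Literature.Analysis.FunctionSpaces.Torus.IsSpaceTimeTestIoo T ψ) :
    ∫ t in Ioo 0 T, ∫ x, ⟪v t (x + Pi.single (2 : Fin 3) s), ψ t x⟫_ℝ =
      ∫ t in Ioo 0 T, ∫ x, ⟪v t x, ψ t x⟫_ℝ := by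
  set e : UnitAddTorus (Fin 3) := Pi.single (2 : Fin 3) s with he
  -- ### the invariant exact-datum Hopf solutions `U j`
  have hf : AEStronglyMeasurable
      (Literature.Analysis.FunctionSpaces.Torus.stLift
        (0 : ℝ → UnitAddTorus (Fin 3) → EuclideanSpace ℝ (Fin 3)))
      (volume.restrict (Ioi 0 ×ˢ univ)) :=
    aestronglyMeasurable_const (b := (0 : EuclideanSpace ℝ (Fin 3)))
  have hf₂ : ∀ T', 0 < T' → ∫⁻ s in Ioo 0 T', ∫⁻ x : UnitAddTorus (Fin 3),
      ‖(0 : ℝ → UnitAddTorus (Fin 3) → EuclideanSpace ℝ (Fin 3)) s x‖ₑ ^ 2 < ⊤ :=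
    fun T' _ => by simp
  choose U hUg hUinv using fun j =>
    Literature.Analysis.FluidPDE.hopf_existence_torus_invariant_holds (ν j) (hν j) u₀ hu₀ hdiv hinv₀
      0 hf hf₂ (fun _ _ _ => rfl)
  have hUT : ∀ j, Literature.Analysis.FluidPDE.Torus.IsLerayHopfOn T (ν j) 0 u₀ (U j) :=
    fun j => hUg j T hT
  -- ### the stability moduli `δ j` and the stability estimate
  set δ : ℕ → ℝ := fun j => (∫ x, ‖w₀ j x - u₀ x‖ ^ 2) *
      Real.exp (ν j * T + 162 * Literature.Analysis.FunctionSpaces.Torus.anisotropicConst.toReal ^ 2 /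
        ν j ^ 2 * ∫ x, ‖u₀ x‖ ^ 2) with hδ
  have hδlim : Tendsto δ atTop (𝓝 0) := hclose
  have hstab : ∀ j, ∀ t ∈ Ioc 0 T, ∫ x, ‖u j t x - U j t x‖ ^ 2 ≤ δ j := by
    intro j t ht
    refine ((hu j).integral_norm_sub_sq_le_mul_exp_of_invariant (hUT j) (hν j) hT (hw₀ j) hu₀
      (hUinv j) ht).trans ?_
    have htT : ν j * t ≤ ν j * T := mul_le_mul_of_nonneg_left ht.2 (hν j).le
    exact mul_le_mul_of_nonneg_left (Real.exp_le_exp.2 (by linarith))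
      (integral_nonneg fun _ => sq_nonneg _)
  -- ### the pairings of `u j - U j` against any test field vanish in the limit
  have hvol : volume.real (Ioo (0 : ℝ) T) = T := by
    rw [Real.volume_real_Ioo_of_le hT.le, sub_zero]
  have hpair : ∀ χ : ℝ → UnitAddTorus (Fin 3) → EuclideanSpace ℝ (Fin 3),
      Literature.Analysis.FunctionSpaces.Torus.IsSpaceTimeTestIoo T χ →
        Tendsto (fun j => (∫ t in Ioo 0 T, ∫ x, ⟪u j t x, χ t x⟫_ℝ) -
          ∫ t in Ioo 0 T, ∫ x, ⟪U j t x, χ t x⟫_ℝ) atTop (𝓝 0) := by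
    intro χ hχ
    obtain ⟨M, hM0, hM⟩ := exists_norm_le_of_isSpaceTimeTest hχ.1
    have hbound : ∀ j, ‖(∫ t in Ioo 0 T, ∫ x, ⟪u j t x, χ t x⟫_ℝ) -
        ∫ t in Ioo 0 T, ∫ x, ⟪U j t x, χ t x⟫_ℝ‖ ≤ M * Real.sqrt (δ j) * T := by
      intro j
      rw [← integral_sub (integrableOn_integral_inner_test (hu j) (hν j).le hχ.1)
        (integrableOn_integral_inner_test (hUT j) (hν j).le hχ.1)]
      calc ‖∫ t in Ioo 0 T, ((∫ x, ⟪u j t x, χ t x⟫_ℝ) - ∫ x, ⟪U j t x, χ t x⟫_ℝ)‖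
          ≤ (M * Real.sqrt (δ j)) * volume.real (Ioo (0 : ℝ) T) := by
            refine norm_setIntegral_le_of_norm_le_const measure_Ioo_lt_top fun t ht => ?_
            have ht' : t ∈ Icc 0 T := Ioo_subset_Icc_self ht
            have hut : MemLp (u j t) 2 volume := (hu j).memLp t ht'
            have hUt : MemLp (U j t) 2 volume := (hUT j).memLp t ht'
            have hχc : Continuous (χ t) := (hχ.1.isSmooth_slice t).continuous
            rw [← integral_sub (integrable_inner_of_memLp_of_continuous hut hχc (hM t ht'))
              (integrable_inner_of_memLp_of_continuous hUt hχc (hM t ht'))]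
            simp_rw [← inner_sub_left]
            calc ‖∫ x, ⟪u j t x - U j t x, χ t x⟫_ℝ‖
                ≤ M * Real.sqrt (∫ x, ‖u j t x - U j t x‖ ^ 2) :=
                  norm_integral_inner_le_mul_sqrt (hut.sub hUt) (hM t ht')
              _ ≤ M * Real.sqrt (δ j) :=
                  mul_le_mul_of_nonneg_left (Real.sqrt_le_sqrt (hstab j t ⟨ht.1, ht.2.le⟩)) hM0
        _ = M * Real.sqrt (δ j) * T := by rw [hvol]
    have hlim0 : Tendsto (fun j => M * Real.sqrt (δ j) * T) atTop (𝓝 0) := by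
      have h1 : Tendsto (fun j => Real.sqrt (δ j)) atTop (𝓝 0) := by
        have := (Real.continuous_sqrt.tendsto 0).comp hδlim
        rwa [Real.sqrt_zero] at this
      simpa using (h1.const_mul M).mul_const T
    exact squeeze_zero_norm hbound hlim0
  -- ### the translated test field and the change of variables
  set ψ' : ℝ → UnitAddTorus (Fin 3) → EuclideanSpace ℝ (Fin 3) := fun t x => ψ t (x + -e) with hψ'
  have hψ't : Literature.Analysis.FunctionSpaces.Torus.IsSpaceTimeTestIoo T ψ' :=
    isSpaceTimeTestIoo_comp_add_space hψ (-e)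
  have hcv : ∀ (w : UnitAddTorus (Fin 3) → EuclideanSpace ℝ (Fin 3)) (t : ℝ),
      ∫ x, ⟪w x, ψ' t x⟫_ℝ = ∫ x, ⟪w (x + e), ψ t x⟫_ℝ := by
    intro w t
    rw [← integral_add_right_eq_self (fun x => ⟪w x, ψ' t x⟫_ℝ) e]
    simp [hψ']
  -- the exact-datum solutions pair identically with `ψ'` and `ψ` (everywhere invariance)
  have hUpair : ∀ j, (∫ t in Ioo 0 T, ∫ x, ⟪U j t x, ψ' t x⟫_ℝ) =
      ∫ t in Ioo 0 T, ∫ x, ⟪U j t x, ψ t x⟫_ℝ := by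
    intro j
    refine setIntegral_congr_fun measurableSet_Ioo fun t _ => ?_
    rw [hcv]
    simp_rw [he, hUinv j t s]
  -- ### the two limits agree
  have hA := hlim.2 ψ' hψ't
  have hB := hlim.2 ψ hψ
  have hdiff : Tendsto (fun j => (∫ t in Ioo 0 T, ∫ x, ⟪u j t x, ψ' t x⟫_ℝ) -
      ∫ t in Ioo 0 T, ∫ x, ⟪u j t x, ψ t x⟫_ℝ) atTop (𝓝 0) := by
    have h := (hpair ψ' hψ't).sub (hpair ψ hψ)
    rw [sub_zero] at h
    refine h.congr fun j => ?_
    rw [hUpair j]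
    ring
  have hdiff' := hA.sub hB
  have h0 : (∫ t in Ioo 0 T, ∫ x, ⟪v t x, ψ' t x⟫_ℝ) - ∫ t in Ioo 0 T, ∫ x, ⟪v t x, ψ t x⟫_ℝ = 0 :=
    tendsto_nhds_unique hdiff' hdiff
  have h4 : (fun t => ∫ x, ⟪v t x, ψ' t x⟫_ℝ) = fun t => ∫ x, ⟪v t (x + e), ψ t x⟫_ℝ :=
    funext fun t => hcv (v t) t
  rw [h4] at h0
  exact sub_eq_zero.1 h0

end Literature.Barriers.AnomalousDissipation

end
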